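import Mathlib.RepresentationTheory.Character
import Mathlib.LinearAlgebra.TensorProduct.Basis
import Mathlib.RingTheory.Flat.Basic
import HarnessLib

/-!
# Functions of two finite variables with slices in prescribed subspaces
(trunk ArithGeomL / CplxAlg; infrastructure for the Kronecker bound
`orbitMultiplicity_det_le_kroneckerCoeff` of `SchurWeylPlethysm`)

For finite sets `α, β` and a field `k`, the coordinate isomorphism
`(α → k) ⊗ (β → k) ≃ (α × β → k)`, `y ⊗ x ↦ ((a, b) ↦ y a · x b)` (`pairFunEquiv`, the basis
`e_a ⊗ e_b`), identifies, for subspaces `Y ≤ k^α` and `X ≤ k^β`, the subspace `Y ⊗ X` with the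
space `sliceSubmodule Y X` of functions `M : α × β → k` all of whose partial functions
`a ↦ M (a, b)` lie in `Y` and `b ↦ M (a, b)` lie in `X` (`sliceEquiv`;
"`(Y ⊗ k^β) ∩ (k^α ⊗ X) = Y ⊗ X`"). Given representations `ρ₁` of a group `G` on `k^α` and `ρ₂`
on `k^β`, the tensor product representation transported to `α × β → k` is `pairRep ρ₁ ρ₂`
(`pairRep_apply_apply` computes it in coordinates); if `Y` and `X` are stable, the slice space is
stable and `sliceEquiv` is an equivalence of representations with `Y ⊗ X` (`sliceRepEquiv`), so
that the dimension of its `G`-invariants is the average of `χ_Y χ_X` over `G`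
(`card_mul_finrank_invariants_sliceRep`, Mathlib's `card_inv_mul_sum_char_eq_finrank` and
`char_tensor`). Downstream (`SchurWeylPlethysmKroneckerBoundProofs`) this is applied twice with
`G = 𝔖_D` permuting the positions of words: to coefficient matrices of pair-word polynomials, and
to the factorisation of words in the alphabet `Fin m × Fin m`.

## Sources

* W. Fulton, J. Harris, *Representation Theory. A First Course*, GTM 129 (1991), §1.1–§2.1
  ((1.4) `Hom(V, W) = V^* ⊗ W`; Prop. 2.1, `χ_{V⊗W} = χ_V χ_W`; (2.9), `dim V^G = |G|⁻¹ ∑ χ_V`).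
  [cite: FultonHarrisGTM129, §2.1 Prop. 2.1 and §2.2 (2.9)]

## Mathlib

Used: `Module.Basis.tensorProduct` (`tensorProduct_repr_tmul_apply`, `tensorProduct_apply`),
`Module.Basis.equivFun` (`equivFun_apply`, `equivFun_symm_apply`), `Pi.basisFun`,
`TensorProduct.map_injective_of_flat_flat` (vector spaces are flat), `Module.finBasis`,
`LinearMap.exists_leftInverse_of_injective`, `Representation.tprod` (`tprod_apply`),
`Representation.Equiv.mk`, `Representation.char_iso`, `Representation.char_tensor`,
`Representation.card_inv_mul_sum_char_eq_finrank`. Mathlib has no named isomorphism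
`(α → k) ⊗ (β → k) ≃ (α × β → k)` for `Pi` types and no slice characterisation of `Y ⊗ X`.

## Design

`namespace Literature.CplxAlg`; `k` a field throughout (injectivity of `Y ⊗ X → k^α ⊗ k^β` and the
surjectivity onto the slice space use linear algebra over a field). `pairRep` is defined by an
explicit coordinate formula-free conjugation `Θ ∘ (ρ₁ g ⊗ ρ₂ g) ∘ Θ⁻¹`, and `pairRep_apply_apply`
is the coordinate formula used by the applications.
-/

noncomputable section

open scoped BigOperators TensorProduct

namespace Literature.NumberTheory.DiophantineGeometry

variable {k : Type*} [Field k] {α β : Type*} [Fintype α] [Fintype β]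

/-! ### The coordinate isomorphism `k^α ⊗ k^β ≃ k^{α × β}` -/

variable (k α β) in
/-- The coordinate isomorphism `(α → k) ⊗ (β → k) ≃ₗ (α × β → k)`, `y ⊗ x ↦ ((a,b) ↦ y a · x b)`:
coordinates in the basis `e_a ⊗ e_b` (Mathlib's `Module.Basis.tensorProduct` of the standard
bases, `Pi.basisFun`). Fulton–Harris §1.1. [folklore] -/
def pairFunEquiv : (α → k) ⊗[k] (β → k) ≃ₗ[k] (α × β → k) :=
  ((Pi.basisFun k α).tensorProduct (Pi.basisFun k β)).equivFun

/-- `pairFunEquiv (y ⊗ x) (a, b) = y a * x b`. [folklore] -/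
@[simp]
theorem pairFunEquiv_tmul (y : α → k) (x : β → k) (p : α × β) :
    pairFunEquiv k α β (y ⊗ₜ x) p = y p.1 * x p.2 := by
  obtain ⟨a, b⟩ := p
  rw [pairFunEquiv, Module.Basis.equivFun_apply, Module.Basis.tensorProduct_repr_tmul_apply,
    Pi.basisFun_repr, Pi.basisFun_repr, smul_eq_mul, mul_comm]

/-- The inverse coordinate isomorphism on a function of two variables:
`M ↦ ∑_{a,b} M (a,b) • e_a ⊗ e_b`. [folklore] -/
theorem pairFunEquiv_symm_apply [DecidableEq α] [DecidableEq β] (M : α × β → k) :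
    (pairFunEquiv k α β).symm M =
      ∑ p : α × β, M p • ((Pi.single p.1 (1 : k) : α → k) ⊗ₜ[k] (Pi.single p.2 (1 : k) : β → k)) := by
  rw [pairFunEquiv, Module.Basis.equivFun_symm_apply]
  refine Finset.sum_congr rfl fun p _ => ?_
  rw [Module.Basis.tensorProduct_apply, Pi.basisFun_apply, Pi.basisFun_apply]

/-! ### Functions with slices in prescribed subspaces -/

variable (Y : Submodule k (α → k)) (X : Submodule k (β → k))

/-- The subspace of functions `M : α × β → k` whose partial functions `a ↦ M (a, b)` all lie in
`Y ≤ k^α` and `b ↦ M (a, b)` all lie in `X ≤ k^β` (for matrices: columns in `Y`, rows in `X`).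
It is the coordinate image of `Y ⊗ X` (`sliceEquiv`). Fulton–Harris §1.1. [folklore] -/
def sliceSubmodule : Submodule k (α × β → k) where
  carrier := {M | (∀ b, (fun a => M (a, b)) ∈ Y) ∧ ∀ a, (fun b => M (a, b)) ∈ X}
  add_mem' hM hM' :=
    ⟨fun b => Y.add_mem (hM.1 b) (hM'.1 b), fun a => X.add_mem (hM.2 a) (hM'.2 a)⟩
  zero_mem' := ⟨fun _ => Y.zero_mem, fun _ => X.zero_mem⟩
  smul_mem' c _ hM := ⟨fun b => Y.smul_mem c (hM.1 b), fun a => X.smul_mem c (hM.2 a)⟩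

omit [Fintype α] [Fintype β] in
variable {Y X} in
/-- Membership in the slice space (unfolding lemma). [folklore] -/
theorem mem_sliceSubmodule_iff (M : α × β → k) :
    M ∈ sliceSubmodule Y X ↔ (∀ b, (fun a => M (a, b)) ∈ Y) ∧ ∀ a, (fun b => M (a, b)) ∈ X :=
  Iff.rfl

/-- The coordinate map `Y ⊗ X → (α × β → k)`, `y ⊗ x ↦ ((a,b) ↦ y a · x b)`. [folklore] -/
def sliceMap : Y ⊗[k] X →ₗ[k] (α × β → k) :=
  (pairFunEquiv k α β).toLinearMap ∘ₗ TensorProduct.map Y.subtype X.subtype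

/-- `sliceMap (y ⊗ x) (a, b) = y a * x b`. [folklore] -/
@[simp]
theorem sliceMap_tmul (y : Y) (x : X) (p : α × β) :
    sliceMap Y X (y ⊗ₜ x) p = (y : α → k) p.1 * (x : β → k) p.2 := by
  simp [sliceMap]

/-- The coordinate map `Y ⊗ X → k^{α × β}` is injective (vector spaces are flat). [folklore] -/
theorem sliceMap_injective : Function.Injective (sliceMap Y X) := by
  rw [sliceMap, LinearMap.coe_comp]
  exact (pairFunEquiv k α β).injective.comp
    (TensorProduct.map_injective_of_flat_flat _ _ Y.injective_subtype X.injective_subtype)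

/-- The coordinate map `Y ⊗ X → k^{α × β}` lands in the slice space. [folklore] -/
theorem sliceMap_mem (t : Y ⊗[k] X) : sliceMap Y X t ∈ sliceSubmodule Y X := by
  induction t using TensorProduct.induction_on with
  | zero =>
    rw [map_zero]
    exact (sliceSubmodule Y X).zero_mem
  | tmul y x =>
    refine ⟨fun b => ?_, fun a => ?_⟩
    · have : (fun a => sliceMap Y X (y ⊗ₜ x) (a, b)) = (x : β → k) b • (y : α → k) := by
        funext a
        rw [sliceMap_tmul, Pi.smul_apply, smul_eq_mul, mul_comm]
      rw [this]
      exact Y.smul_mem _ y.2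
    · have : (fun b => sliceMap Y X (y ⊗ₜ x) (a, b)) = (y : α → k) a • (x : β → k) := by
        funext b
        rw [sliceMap_tmul, Pi.smul_apply, smul_eq_mul]
      rw [this]
      exact X.smul_mem _ x.2
  | add s t hs ht =>
    rw [map_add]
    exact (sliceSubmodule Y X).add_mem hs ht

/-- **The slice space is the image of `Y ⊗ X`**: a function `M` with all slices `a ↦ M (a,b)`
in `Y` and `b ↦ M (a,b)` in `X` is `∑_j c_j ⊗ x_j` for a basis `(x_j)` of `X`, where the
coordinate functions `c_j (a) = x_j^*(M (a, ·))` are linear combinations of the slices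
`a ↦ M (a, b)` (extend `x_j^*` to a functional on `k^β`), hence lie in `Y`
("`(Y ⊗ k^β) ∩ (k^α ⊗ X) = Y ⊗ X`"). Fulton–Harris §1.1. [folklore] -/
theorem exists_sliceMap_eq {M : α × β → k} (hM : M ∈ sliceSubmodule Y X) :
    ∃ t : Y ⊗[k] X, sliceMap Y X t = M := by
  classical
  set bX := Module.finBasis k X with hbX
  -- the rows of `M` as elements of `X`
  set r : α → X := fun a => ⟨fun b => M (a, b), hM.2 a⟩ with hr
  -- a left inverse of the inclusion `X ⊆ k^β`
  obtain ⟨π, hπ⟩ := LinearMap.exists_leftInverse_of_injective X.subtype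
    (LinearMap.ker_eq_bot.mpr X.injective_subtype)
  have hπr : ∀ a, π (fun b => M (a, b)) = r a := fun a => by
    have := LinearMap.congr_fun hπ (r a)
    rwa [LinearMap.comp_apply, LinearMap.id_apply] at this
  -- the coordinate functions `c_j` and their membership in `Y`
  have hc : ∀ j, (fun a => bX.repr (r a) j) ∈ Y := by
    intro j
    have hexp : (fun a => bX.repr (r a) j) =
        ∑ b : β, (bX.coord j (π (Pi.single b 1))) • fun a => M (a, b) := by
      funext a
      rw [← hπr a]
      have hMa : (fun b => M (a, b)) = ∑ b : β, M (a, b) • (Pi.single b (1 : k) : β → k) := by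
        funext b'
        simp only [Finset.sum_apply, Pi.smul_apply, Pi.single_apply, smul_eq_mul, mul_ite,
          mul_one, mul_zero]
        rw [Finset.sum_ite_eq, if_pos (Finset.mem_univ _)]
      rw [hMa, map_sum, map_sum]
      simp only [map_smul, Finsupp.coe_finsetSum, Finsupp.coe_smul, Finset.sum_apply,
        Pi.smul_apply, smul_eq_mul, Module.Basis.coord_apply, mul_comm (M (a, _))]
    rw [hexp]
    exact Y.sum_mem fun b _ => Y.smul_mem _ (hM.1 b)
  refine ⟨∑ j, (⟨fun a => bX.repr (r a) j, hc j⟩ : Y) ⊗ₜ bX j, ?_⟩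
  funext p
  obtain ⟨a, b⟩ := p
  rw [map_sum, Finset.sum_apply]
  simp only [sliceMap_tmul]
  have key := congrArg (fun x : X => (x : β → k) b) (bX.sum_repr (r a))
  simp only [Submodule.coe_sum, Submodule.coe_smul, Finset.sum_apply, Pi.smul_apply,
    smul_eq_mul] at key
  exact key

/-- **`Y ⊗ X ≃ sliceSubmodule Y X`**, the coordinate isomorphism `y ⊗ x ↦ ((a,b) ↦ y a · x b)`
(injective by flatness, surjective by `exists_sliceMap_eq`). Fulton–Harris §1.1. [folklore] -/
def sliceEquiv : Y ⊗[k] X ≃ₗ[k] sliceSubmodule Y X :=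
  LinearEquiv.ofBijective ((sliceMap Y X).codRestrict (sliceSubmodule Y X) (sliceMap_mem Y X))
    ⟨fun s t h => sliceMap_injective Y X (congrArg Subtype.val h),
      fun M => by
        obtain ⟨t, ht⟩ := exists_sliceMap_eq Y X M.2
        exact ⟨t, Subtype.ext ht⟩⟩

/-- `sliceEquiv` is `sliceMap` on underlying functions (unfolding lemma). [folklore] -/
@[simp]
theorem coe_sliceEquiv (t : Y ⊗[k] X) : (sliceEquiv Y X t : α × β → k) = sliceMap Y X t :=
  rfl

/-! ### The tensor product of two representations on functions -/

section Rep

variable {G : Type*} [Group G] (ρ₁ : Representation k G (α → k)) (ρ₂ : Representation k G (β → k))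

/-- The representation `ρ₁ ⊗ ρ₂` of `G` transported to functions of two variables along
`pairFunEquiv`: `g ↦ Θ ∘ (ρ₁ g ⊗ ρ₂ g) ∘ Θ⁻¹`. Fulton–Harris §1.1. [folklore] -/
def pairRep : Representation k G (α × β → k) where
  toFun g := (pairFunEquiv k α β).toLinearMap ∘ₗ TensorProduct.map (ρ₁ g) (ρ₂ g) ∘ₗ
    (pairFunEquiv k α β).symm.toLinearMap
  map_one' := by
    apply LinearMap.ext
    intro M
    change pairFunEquiv k α β (TensorProduct.map (ρ₁ 1) (ρ₂ 1) ((pairFunEquiv k α β).symm M)) = M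
    rw [map_one, map_one, TensorProduct.map_one, Module.End.one_apply,
      LinearEquiv.apply_symm_apply]
  map_mul' g h := by
    apply LinearMap.ext
    intro M
    simp only [map_mul, TensorProduct.map_mul, LinearMap.coe_comp, Function.comp_apply,
      LinearEquiv.coe_coe, Module.End.mul_apply, LinearEquiv.symm_apply_apply]

/-- Unfolding lemma for `pairRep`. [folklore] -/
theorem pairRep_apply (g : G) (M : α × β → k) :
    pairRep ρ₁ ρ₂ g M =
      pairFunEquiv k α β (TensorProduct.map (ρ₁ g) (ρ₂ g) ((pairFunEquiv k α β).symm M)) :=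
  rfl

/-- `pairRep` on the coordinate image of a pure tensor: `g · Θ(y ⊗ x) = Θ(ρ₁(g) y ⊗ ρ₂(g) x)`.
[folklore] -/
theorem pairRep_pairFunEquiv_tmul (g : G) (y : α → k) (x : β → k) :
    pairRep ρ₁ ρ₂ g (pairFunEquiv k α β (y ⊗ₜ x)) = pairFunEquiv k α β (ρ₁ g y ⊗ₜ ρ₂ g x) := by
  rw [pairRep_apply, LinearEquiv.symm_apply_apply, TensorProduct.map_tmul]

/-- **Coordinate formula.** `(g · M)(a, b) = ∑_{a',b'} M (a',b') (ρ₁(g) e_{a'})(a) (ρ₂(g) e_{b'})(b)`.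
[folklore] -/
theorem pairRep_apply_apply [DecidableEq α] [DecidableEq β] (g : G) (M : α × β → k)
    (p : α × β) :
    pairRep ρ₁ ρ₂ g M p =
      ∑ q : α × β, M q * (ρ₁ g (Pi.single q.1 1) p.1 * ρ₂ g (Pi.single q.2 1) p.2) := by
  rw [pairRep_apply, pairFunEquiv_symm_apply, map_sum, map_sum, Finset.sum_apply]
  refine Finset.sum_congr rfl fun q _ => ?_
  rw [map_smul, map_smul, Pi.smul_apply, TensorProduct.map_tmul, pairFunEquiv_tmul, smul_eq_mul]

/-- `pairFunEquiv` is an equivalence of representations `ρ₁ ⊗ ρ₂ ≃ pairRep ρ₁ ρ₂`. [folklore] -/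
def pairRepEquiv : (ρ₁.tprod ρ₂).Equiv (pairRep ρ₁ ρ₂) :=
  Representation.Equiv.mk (pairFunEquiv k α β) fun g => by
    apply LinearMap.ext
    intro t
    rw [LinearMap.comp_apply, LinearMap.comp_apply, LinearEquiv.coe_coe, Representation.tprod_apply]
    change _ = pairFunEquiv k α β (TensorProduct.map (ρ₁ g) (ρ₂ g)
      ((pairFunEquiv k α β).symm (pairFunEquiv k α β t)))
    rw [LinearEquiv.symm_apply_apply]

variable {ρ₁ ρ₂ Y X}
variable (hY : ∀ g, Y ≤ Y.comap (ρ₁ g)) (hX : ∀ g, X ≤ X.comap (ρ₂ g))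

include hY hX in
/-- If `Y` and `X` are stable then so is the slice space: `g · Θ(t) = Θ((ρ_Y ⊗ ρ_X)(g) t)` for
`t ∈ Y ⊗ X`. [folklore] -/
theorem pairRep_sliceMap (g : G) (t : Y ⊗[k] X) :
    pairRep ρ₁ ρ₂ g (sliceMap Y X t) =
      sliceMap Y X (((ρ₁.subrepresentation Y hY).tprod (ρ₂.subrepresentation X hX)) g t) := by
  induction t using TensorProduct.induction_on with
  | zero => simp only [map_zero]
  | tmul y x =>
    rw [Representation.tprod_apply, TensorProduct.map_tmul]
    change pairRep ρ₁ ρ₂ g (pairFunEquiv k α β ((y : α → k) ⊗ₜ (x : β → k))) =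
      pairFunEquiv k α β ((ρ₁ g y : α → k) ⊗ₜ (ρ₂ g x : β → k))
    exact pairRep_pairFunEquiv_tmul ρ₁ ρ₂ g y x
  | add s t hs ht => simp only [map_add, hs, ht]

include hY hX in
/-- If `Y ≤ k^α` is `ρ₁`-stable and `X ≤ k^β` is `ρ₂`-stable then `sliceSubmodule Y X` is
`pairRep ρ₁ ρ₂`-stable. [folklore] -/
theorem sliceSubmodule_le_comap_pairRep (g : G) :
    sliceSubmodule Y X ≤ (sliceSubmodule Y X).comap (pairRep ρ₁ ρ₂ g) := by
  intro M hM
  obtain ⟨t, rfl⟩ := exists_sliceMap_eq Y X hM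
  rw [Submodule.mem_comap, pairRep_sliceMap hY hX]
  exact sliceMap_mem Y X _

/-- The representation of `G` on the slice space (restriction of `pairRep ρ₁ ρ₂`). [folklore] -/
def sliceRep : Representation k G (sliceSubmodule Y X) :=
  (pairRep ρ₁ ρ₂).subrepresentation (sliceSubmodule Y X) (sliceSubmodule_le_comap_pairRep hY hX)

/-- `sliceRep` acts as `pairRep` on underlying functions (unfolding lemma). [folklore] -/
@[simp]
theorem coe_sliceRep_apply (g : G) (M : sliceSubmodule Y X) :
    ((sliceRep hY hX g M : sliceSubmodule Y X) : α × β → k) = pairRep ρ₁ ρ₂ g M :=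
  rfl

/-- **`Y ⊗ X ≃ sliceSubmodule Y X` as representations of `G`** (`sliceEquiv` intertwines the
tensor product of the restricted representations with `sliceRep`). Fulton–Harris §1.1.
[folklore] -/
def sliceRepEquiv :
    ((ρ₁.subrepresentation Y hY).tprod (ρ₂.subrepresentation X hX)).Equiv (sliceRep hY hX) :=
  Representation.Equiv.mk (sliceEquiv Y X) fun g => by
    apply LinearMap.ext
    intro t
    apply Subtype.ext
    change sliceMap Y X (((ρ₁.subrepresentation Y hY).tprod (ρ₂.subrepresentation X hX)) g t) =
      pairRep ρ₁ ρ₂ g (sliceMap Y X t)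
    rw [pairRep_sliceMap hY hX]

/-- **Dimension of the invariants of the slice representation**: for a finite group `G` with
`|G|` invertible in `k`,
`|G| · dim (sliceSubmodule Y X)^G = ∑_{g ∈ G} χ_Y(g) χ_X(g)`, where `χ_Y`, `χ_X` are the
characters of the restricted representations (`dim V^G = |G|⁻¹ ∑ χ_V`, Fulton–Harris (2.9),
applied to `V = Y ⊗ X ≃ sliceSubmodule Y X`, with `χ_{Y ⊗ X} = χ_Y χ_X`, Prop. 2.1).
[cite: FultonHarrisGTM129, §2.2 (2.9) with Prop. 2.1] -/
theorem card_mul_finrank_invariants_sliceRep [Fintype G] [Invertible (Nat.card G : k)] :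
    (Nat.card G : k) * (Module.finrank k (sliceRep hY hX).invariants : k) =
      ∑ g : G, (ρ₁.subrepresentation Y hY).character g *
        (ρ₂.subrepresentation X hX).character g := by
  have h := Representation.card_inv_mul_sum_char_eq_finrank (sliceRep hY hX)
  have hiso : ((ρ₁.subrepresentation Y hY).tprod (ρ₂.subrepresentation X hX)).character =
      (sliceRep hY hX).character :=
    Representation.char_iso (V := ↥Y ⊗[k] ↥X) (sliceRepEquiv hY hX)
  rw [← hiso, Representation.char_tensor] at h
  rw [← h, ← mul_assoc, mul_inv_cancel₀ (Invertible.ne_zero _), one_mul]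
  rfl

end Rep

end Literature.NumberTheory.DiophantineGeometry
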